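import Summits.PneNP.PneNP.Theses.NoTardosTropics
import Literature.Computability.Complexity.MPGRealNDPAdd
import HarnessLib

/-!
# Route NoTardosTropics, support item `MPGRealMemNDPadd`: `MPG_ℝ ∈ NDP⁰_add`

The item (stmt-PneNP-2567) is, after unfolding, literally
`Literature.Computability.Complexity.MPGReal ∈ Literature.Computability.Complexity.NDPAdd`
(the route inlines the bodies of `MPGReal`, `signOracle` and `NDPAdd` of
`Literature/Computability/Complexity/{MeanPayoffGame,AdditiveRealClasses}.lean`), which is the
Literature theorem `Literature.Computability.Complexity.MPGReal_mem_NDPAdd`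
(`MPGRealNDPAdd.lean`): the real mean-payoff language is accepted by the polynomial-time
sign-query certificate verifier `MPGSignVerifier.verifier` with Boolean witnesses — the witness
names Max's positional choice `σ`, the closed set `R`, the owner/edge claims, and a potential that
is an integer combination of the weights (short-walk potentials exist whenever a real potential
does, `Literature.Combinatorics.Optimization.exists_shortWalkPotential`), so that every condition
of the certificate is one sign query [FournierKoiran2000, §3; ZwickPaterson1995, Thm 7;
CLRS2009, Thm 24.9].
-/

set_option linter.dupNamespace false -- `Summit.PneNP.PneNP.…`: summit = sub-problem name (D-0017 single-conjunct layout)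

namespace Summit.PneNP.PneNP.Theorems

/-- **`MPG_ℝ ∈ NDP⁰_add`** (route NoTardosTropics, item stmt-PneNP-2567): the real mean-payoff
language has a polynomial-time sign-query verifier with Boolean witnesses of polynomial length —
`Literature.Computability.Complexity.MPGReal_mem_NDPAdd`, the route decl being its unfolding.
[cite: FournierKoiran2000, §3 (NDP⁰_ℝovs)] -/
theorem MPGRealMemNDPadd_proof : Summit.PneNP.PneNP.Theses.NoTardosTropics.MPGRealMemNDPadd := by
  unfold Summit.PneNP.PneNP.Theses.NoTardosTropics.MPGRealMemNDPadd
  exact Literature.Computability.Complexity.MPGReal_mem_NDPAdd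

end Summit.PneNP.PneNP.Theorems
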